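import Literature.NumberTheory.LFunctions.PrimitiveQuadraticCharacterModulus
import Literature.NumberTheory.LFunctions.DirichletCharacterCRT
import Literature.NumberTheory.QuadraticFields.JacobiCharacter
import Mathlib.Data.Nat.Factorization.Basic
import HarnessLib

/-!
# An odd primitive quadratic Dirichlet character mod `q` is the Kronecker symbol `(−q/·)`

Topic `Literature/NumberTheory/LFunctions`, namespace
`Literature.NumberTheory.LFunctions.PrimitiveQuadratic` (continuing `PrimitiveQuadraticCharacter.lean`,
the odd squarefree case, and `PrimitiveQuadraticCharacterModulus.lean`). Everything here is PROVED
(theorems only, no definitions, no named facts).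

The classical theorem "the real primitive characters are exactly the Kronecker symbols `(D/·)` of the
fundamental discriminants `D`, with `χ(−1) = sign D`" (Davenport, *Multiplicative Number Theory*,
Ch. 5; Montgomery–Vaughan, *Multiplicative Number Theory I*, §9.3, Theorem 9.13) in the form needed
to identify the odd real primitive character mod `q` of the Siegel-zero statements
(`Literature.NumberTheory.DiophantineGeometry.NoSiegelZerosOddQuadratic`) with the character of the
imaginary quadratic field of discriminant `−q`:

* `level_two_pow_le_three` — a primitive quadratic character mod `2^k` has `k ≤ 3`
  (for `k ≥ 4`, `1 + 2^{k−1} ≡ (1 + 2^{k−2})²` is a square, so `χ` is trivial on the kernel of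
  `(ℤ/2^k)ˣ → (ℤ/2^{k−1})ˣ`);
* `apply_three_of_isPrimitive_four`, `apply_five_of_isPrimitive_eight` — a primitive quadratic
  character mod `4` has `χ(3) = −1`; mod `8` it has `χ(5) = −1` (MV §9.3: the real primitive
  characters of `2`-power conductor are `χ₄`, `χ₈`, `χ₄χ₈`);
* `apply_natCast_eq_jacobiSym_neg_of_odd` — **for `χ` primitive, quadratic and odd mod `q` and every
  odd `n`: `χ(n) = (−q/n)`** (Jacobi symbol; at an odd prime `p` this is the Legendre symbol
  `(−q/p)`, `apply_prime_eq_legendreSym_neg_of_odd`). Proof: `q = 2^k m`, `m` odd; `χ = χ₂ ⊗ χ_m`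
  (CRT components, `DirichletCharacterCRT.lean`), `χ_m = (·/m)` (`apply_natCast_eq_jacobiSym`, `m`
  squarefree), `k ∈ {0, 2, 3}`, and the values of `χ₂` together with the parity `χ(−1) = −1` and
  quadratic reciprocity give `(−q/n)` in each case;
* `apply_two_eq_one_of_odd`, `apply_two_eq_neg_one_of_odd` (`q` odd: `χ(2) = ±1` according as
  `−q ≡ 1, 5 (mod 8)`), `apply_two_of_even` (`q` even: `χ(2) = 0`);
* `isFundamentalDiscriminant_neg` — **`−q` is a fundamental discriminant**: `−q ≡ 1 (mod 4)`
  squarefree, or `−q = 4m'` with `m' ≡ 2, 3 (mod 4)` squarefree (spelled out as in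
  `QuadraticFields/FundamentalDiscriminant.lean`).

## References

* [MontgomeryVaughan2007] H. L. Montgomery, R. C. Vaughan, *Multiplicative Number Theory I*, CUP
  2007, §9.3, Theorem 9.13 (and Lemma 9.3 for the CRT decomposition).
* H. Davenport, *Multiplicative Number Theory*, 3rd ed., GTM 74 (2000), Ch. 5.
-/

noncomputable section

open DirichletCharacter Finset
open scoped NumberTheorySymbols

namespace Literature.NumberTheory.LFunctions.PrimitiveQuadratic

/-! ### A criterion for factoring through a divisor -/

/-- If `χ` mod `N` is `1` at every `a < N` coprime to `N` with `a ≡ 1 (mod n)` (`n ∣ N`, `n > 1`),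
then `χ` factors through `n` (`factorsThrough_iff_ker_unitsMap`). [folklore] -/
theorem factorsThrough_of_forall_lt {N n : ℕ} [NeZero N] (hn : n ∣ N) (hn1 : 1 < n)
    (χ : DirichletCharacter ℂ N)
    (h : ∀ a : ℕ, a < N → a.Coprime N → a % n = 1 → χ (a : ZMod N) = 1) : χ.FactorsThrough n := by
  haveI : NeZero n := ⟨by omega⟩
  rw [factorsThrough_iff_ker_unitsMap hn]
  intro x hx
  rw [MonoidHom.mem_ker, ZMod.unitsMap_def, Units.ext_iff, Units.coe_map, MonoidHom.coe_coe,
    ZMod.castHom_apply, Units.val_one] at hx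
  rw [MonoidHom.mem_ker, Units.ext_iff, MulChar.coe_toUnitHom, Units.val_one]
  set a : ℕ := (x : ZMod N).val with ha
  have hxa : (x : ZMod N) = (a : ZMod N) := (ZMod.natCast_zmod_val _).symm
  have hcop : a.Coprime N := ZMod.val_coe_unit_coprime x
  have hlt : a < N := ZMod.val_lt _
  have hmod : a % n = 1 := by
    rw [ZMod.cast_eq_val] at hx
    have h' : ((a : ℕ) : ZMod n) = ((1 : ℕ) : ZMod n) := by rw [Nat.cast_one]; exact hx
    have := (ZMod.natCast_eq_natCast_iff _ _ _).mp h'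
    rw [Nat.ModEq, Nat.mod_eq_of_lt hn1] at this
    exact this
  rw [hxa]
  exact h a hlt hcop hmod

/-- A primitive character does not factor through a proper divisor. [folklore] -/
theorem not_factorsThrough_of_isPrimitive {N n : ℕ} [NeZero N] {χ : DirichletCharacter ℂ N}
    (hprim : χ.IsPrimitive) (hn : n ∣ N) (hlt : n < N) : ¬ χ.FactorsThrough n := by
  intro hft
  have hdvd : χ.conductor ∣ n := conductor_dvd_of_mem_conductorSet χ ((mem_conductorSet_iff χ).2 hft)
  rw [hprim] at hdvd
  rcases Nat.eq_zero_or_pos n with rfl | hpos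
  · exact NeZero.ne N (Nat.eq_zero_of_zero_dvd hn)
  · exact absurd (Nat.le_of_dvd hpos hdvd) (not_le.mpr hlt)

/-- For a quadratic character, `χ(a)² = 1` at units `a`. [folklore] -/
theorem apply_sq_eq_one_of_isUnit {N : ℕ} {χ : DirichletCharacter ℂ N} (hquad : χ.IsQuadratic)
    {a : ZMod N} (ha : IsUnit a) : χ a ^ 2 = 1 := by
  rcases hquad a with h | h | h
  · exact absurd h (ha.map χ).ne_zero
  · rw [h, one_pow]
  · rw [h]; norm_num

/-- For a quadratic character, `χ(a) = 1` or `χ(a) = −1` at units `a`. [folklore] -/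
theorem apply_eq_one_or_neg_one_of_isUnit {N : ℕ} {χ : DirichletCharacter ℂ N}
    (hquad : χ.IsQuadratic) {a : ZMod N} (ha : IsUnit a) : χ a = 1 ∨ χ a = -1 := by
  rcases hquad a with h | h | h
  · exact absurd h (ha.map χ).ne_zero
  · exact Or.inl h
  · exact Or.inr h

/-! ### Moduli `2^k`: `k ≤ 3`, and the values at `3` (mod `4`) and `5` (mod `8`) -/

/-- **A primitive quadratic character mod `2^k` has `k ≤ 3`.** For `k ≥ 4` the unit
`1 + 2^{k−1} ≡ (1 + 2^{k−2})² (mod 2^k)` is a square, so `χ(1 + 2^{k−1}) = 1`; the units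
`≡ 1 (mod 2^{k−1})` are `1` and `1 + 2^{k−1}`, so `χ` factors through `2^{k−1}`
(the real primitive characters of `2`-power conductor have conductor `4` or `8`, MV §9.3).
[cite: MontgomeryVaughan2007, Theorem 9.13] -/
theorem level_two_pow_le_three {k : ℕ} {χ : DirichletCharacter ℂ (2 ^ k)} (hprim : χ.IsPrimitive)
    (hquad : χ.IsQuadratic) : k ≤ 3 := by
  by_contra hk
  obtain ⟨j, rfl⟩ : ∃ j, k = j + 4 := ⟨k - 4, by omega⟩
  have hdvd : 2 ^ (j + 3) ∣ 2 ^ (j + 4) := pow_dvd_pow 2 (by omega)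
  have hlt : 2 ^ (j + 3) < 2 ^ (j + 4) := Nat.pow_lt_pow_right (by norm_num) (by omega)
  refine not_factorsThrough_of_isPrimitive hprim hdvd hlt
    (factorsThrough_of_forall_lt hdvd (Nat.one_lt_two_pow (by omega)) χ fun a ha hcop hmod => ?_)
  -- `a = 1` or `a = 1 + 2^(j+3)`
  have hP : 2 ^ (j + 4) = 2 * 2 ^ (j + 3) := by ring
  have hdiv : a / 2 ^ (j + 3) < 2 := by
    rw [Nat.div_lt_iff_lt_mul (by positivity)]
    linarith
  have ha' := Nat.div_add_mod a (2 ^ (j + 3))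
  set d := a / 2 ^ (j + 3) with hd_def
  rw [hmod] at ha'
  have hcases : a = 1 ∨ a = 2 ^ (j + 3) + 1 := by
    interval_cases d
    · left; rw [mul_zero, zero_add] at ha'; exact ha'.symm
    · right; rw [mul_one] at ha'; exact ha'.symm
  rcases hcases with rfl | rfl
  · rw [Nat.cast_one, map_one]
  · -- `1 + 2^(j+3) = (1 + 2^(j+2))²` mod `2^(j+4)`
    have hsq : (((2 ^ (j + 3) + 1 : ℕ)) : ZMod (2 ^ (j + 4))) =
        (((2 ^ (j + 2) + 1 : ℕ)) : ZMod (2 ^ (j + 4))) ^ 2 := by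
      rw [← Nat.cast_pow, ZMod.natCast_eq_natCast_iff']
      have e : (2 ^ (j + 2) + 1) ^ 2 = 2 ^ (j + 3) + 1 + 2 ^ (j + 4) * 2 ^ j := by ring
      rw [e, Nat.add_mul_mod_self_left]
    have hu : IsUnit ((((2 ^ (j + 2) + 1 : ℕ)) : ZMod (2 ^ (j + 4)))) := by
      rw [ZMod.isUnit_iff_coprime]
      refine Nat.Coprime.pow_right _ ?_
      rw [Nat.coprime_two_right, Nat.odd_iff]
      have : 2 ^ (j + 2) % 2 = 0 := by
        rw [pow_succ]
        exact Nat.mul_mod_left _ _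
      omega
    rw [hsq, map_pow, apply_sq_eq_one_of_isUnit hquad hu]

/-- **A primitive character mod `4` has `χ(3) = −1`** (if quadratic): `χ(3) ≠ 1` since otherwise
`χ` factors through `2`; it is the character `χ₄`. [cite: MontgomeryVaughan2007, Theorem 9.13] -/
theorem apply_three_of_isPrimitive_four {χ : DirichletCharacter ℂ 4} (hprim : χ.IsPrimitive)
    (hquad : χ.IsQuadratic) : χ (3 : ZMod 4) = -1 := by
  have hu : IsUnit (3 : ZMod 4) := by decide
  rcases apply_eq_one_or_neg_one_of_isUnit hquad hu with h | h
  · exfalso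
    refine not_factorsThrough_of_isPrimitive hprim (by norm_num : 2 ∣ 4) (by norm_num)
      (factorsThrough_of_forall_lt (by norm_num) one_lt_two χ fun a ha hcop hmod => ?_)
    have hcases : a = 1 ∨ a = 3 := by omega
    rcases hcases with rfl | rfl
    · rw [Nat.cast_one, map_one]
    · exact_mod_cast h
  · exact h

/-- **A primitive quadratic character mod `8` has `χ(5) = −1`**: `χ(5) ≠ 1` since otherwise `χ`
is trivial on the kernel `{1, 5}` of `(ℤ/8)ˣ → (ℤ/4)ˣ` and factors through `4`; it is `χ₈` or
`χ₄χ₈`. [cite: MontgomeryVaughan2007, Theorem 9.13] -/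
theorem apply_five_of_isPrimitive_eight {χ : DirichletCharacter ℂ 8} (hprim : χ.IsPrimitive)
    (hquad : χ.IsQuadratic) : χ (5 : ZMod 8) = -1 := by
  have hu : IsUnit (5 : ZMod 8) := by decide
  rcases apply_eq_one_or_neg_one_of_isUnit hquad hu with h | h
  · exfalso
    refine not_factorsThrough_of_isPrimitive hprim (by norm_num : 4 ∣ 8) (by norm_num)
      (factorsThrough_of_forall_lt (by norm_num) (by norm_num) χ fun a ha hcop hmod => ?_)
    have hcases : a = 1 ∨ a = 5 := by omega
    rcases hcases with rfl | rfl
    · rw [Nat.cast_one, map_one]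
    · exact_mod_cast h
  · exact h

/-- The values of a primitive quadratic character mod `4` at odd `n`: `χ(n) = χ₄(n) = (−1/n)`.
[cite: MontgomeryVaughan2007, Theorem 9.13] -/
theorem apply_natCast_four_eq {χ : DirichletCharacter ℂ 4} (hprim : χ.IsPrimitive)
    (hquad : χ.IsQuadratic) {n : ℕ} (hn : Odd n) : χ (n : ZMod 4) = (J(-1 | n) : ℂ) := by
  rw [jacobiSym.at_neg_one hn, ZMod.χ₄_nat_eq_if_mod_four, ← ZMod.natCast_mod n 4]
  have h2 : n % 2 = 1 := Nat.odd_iff.mp hn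
  rw [if_neg (by omega)]
  have h4 : n % 4 = 1 ∨ n % 4 = 3 := by omega
  rcases h4 with h | h
  · rw [h, if_pos rfl, Nat.cast_one, map_one, Int.cast_one]
  · rw [h, if_neg (by norm_num), Int.cast_neg, Int.cast_one]
    exact_mod_cast apply_three_of_isPrimitive_four hprim hquad

/-- The values of a primitive quadratic character mod `8` at odd `n`, in terms of `ε = χ(3) = ±1`:
`χ(n) = 1, ε, −1, −ε` for `n ≡ 1, 3, 5, 7 (mod 8)`. [cite: MontgomeryVaughan2007, Theorem 9.13] -/
theorem apply_natCast_eight_eq {χ : DirichletCharacter ℂ 8} (hprim : χ.IsPrimitive)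
    (hquad : χ.IsQuadratic) {n : ℕ} (hn : Odd n) :
    χ (n : ZMod 8) = if n % 8 = 1 then 1 else if n % 8 = 3 then χ (3 : ZMod 8)
      else if n % 8 = 5 then -1 else -χ (3 : ZMod 8) := by
  have h5 := apply_five_of_isPrimitive_eight hprim hquad
  have h7 : χ (7 : ZMod 8) = -χ (3 : ZMod 8) := by
    rw [show (7 : ZMod 8) = 3 * 5 by decide, map_mul, h5, mul_neg_one]
  rw [← ZMod.natCast_mod n 8]
  have h2 : n % 2 = 1 := Nat.odd_iff.mp hn
  have h8 : n % 8 = 1 ∨ n % 8 = 3 ∨ n % 8 = 5 ∨ n % 8 = 7 := by omega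
  rcases h8 with h | h | h | h <;> rw [h] <;> norm_num [h5, h7]

/-! ### The value of a character of odd modulus at `−1` -/

/-- For `m` odd and squarefree and `χ` primitive quadratic mod `m`: `χ(−1) = χ₄(m)` (also for `m = 1`).
[folklore] -/
theorem apply_neg_one_eq_χ₄ {m : ℕ} [NeZero m] (hodd : Odd m) (hsq : Squarefree m)
    (χ : DirichletCharacter ℂ m) (hprim : χ.IsPrimitive) (hquad : χ.IsQuadratic) :
    χ (-1) = (ZMod.χ₄ m : ℂ) := by
  rcases Nat.lt_or_ge 1 m with h1 | h1
  · rw [apply_neg_one_eq_jacobiSym hodd hsq h1 χ hprim hquad, jacobiSym.at_neg_one hodd]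
  · have hm1 : m = 1 := by
      have := NeZero.pos m
      omega
    subst hm1
    rw [Subsingleton.elim (-1 : ZMod 1) 1, map_one, Nat.cast_one, map_one, Int.cast_one]

/-! ### The Jacobi symbol side -/

/-- `(−4m/n) = (−1/n)(m/n)` for odd `n` (`(4/n) = 1` is Mathlib's `jacobiSym.at_four`).
[folklore] -/
theorem jacobiSym_neg_four_mul {m n : ℕ} (hn : Odd n) :
    J(-(((4 * m : ℕ)) : ℤ) | n) = J(-1 | n) * J((m : ℤ) | n) := by
  rw [show (-(((4 * m : ℕ)) : ℤ)) = (-1) * (4 * (m : ℤ)) by push_cast; ring, jacobiSym.mul_left,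
    jacobiSym.mul_left, jacobiSym.at_four hn, one_mul]

/-- `(−8m/n) = (−2/n)(m/n)` for odd `n`. [folklore] -/
theorem jacobiSym_neg_eight_mul {m n : ℕ} (hn : Odd n) :
    J(-(((8 * m : ℕ)) : ℤ) | n) = J(-2 | n) * J((m : ℤ) | n) := by
  rw [show (-(((8 * m : ℕ)) : ℤ)) = (-2) * (4 * (m : ℤ)) by push_cast; ring, jacobiSym.mul_left,
    jacobiSym.mul_left, jacobiSym.at_four hn, one_mul]

/-! ### Characters mod `2^k m`, `m` odd: the odd part is squarefree, `k ≤ 3`, and parity -/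

section TwoPowMul

variable {k m : ℕ} [NeZero m]

omit [NeZero m] in
/-- `2^k` and an odd `m` are coprime. [folklore] -/
theorem coprime_two_pow_of_odd (k : ℕ) (hm : Odd m) : (2 ^ k).Coprime m :=
  Nat.Coprime.pow_left _ (Nat.coprime_two_left.mpr hm)

/-- The odd part `m` of the modulus of a primitive quadratic character mod `2^k m` is squarefree
(its CRT component mod `m` is primitive quadratic, `squarefree_of_isPrimitive_of_isQuadratic`).
[cite: MontgomeryVaughan2007, Theorem 9.13] -/
theorem squarefree_of_level_two_pow_mul (hm : Odd m) {χ : DirichletCharacter ℂ (2 ^ k * m)}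
    (hprim : χ.IsPrimitive) (hquad : χ.IsQuadratic) : Squarefree m :=
  squarefree_of_isPrimitive_of_isQuadratic hm (isPrimitive_crtSnd (coprime_two_pow_of_odd k hm) hprim)
    (IsQuadratic.crtSnd (coprime_two_pow_of_odd k hm) hquad)

/-- The `2`-part `2^k` of the modulus of a primitive quadratic character mod `2^k m` has `k ≤ 3`
(`level_two_pow_le_three` for the CRT component mod `2^k`). [cite: MontgomeryVaughan2007, Theorem 9.13] -/
theorem le_three_of_level_two_pow_mul (hm : Odd m) {χ : DirichletCharacter ℂ (2 ^ k * m)}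
    (hprim : χ.IsPrimitive) (hquad : χ.IsQuadratic) : k ≤ 3 :=
  level_two_pow_le_three (isPrimitive_crtFst (coprime_two_pow_of_odd k hm) hprim)
    (IsQuadratic.crtFst (coprime_two_pow_of_odd k hm) hquad)

/-- There is no primitive character mod `2m`, `m` odd. [cite: MontgomeryVaughan2007, Theorem 9.13] -/
theorem not_isPrimitive_two_mul (hm : Odd m) {χ : DirichletCharacter ℂ (2 ^ 1 * m)}
    (hprim : χ.IsPrimitive) : False := by
  have h4 := four_dvd_of_isPrimitive_of_even (by rw [pow_one]; exact even_two_mul m) hprim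
  rw [pow_one] at h4
  have : (2 : ℕ) ∣ m := by
    have h2 : 4 ∣ 2 * m := h4
    omega
  exact (Nat.not_even_iff_odd.mpr hm) (even_iff_two_dvd.mpr this)

/-- The CRT decomposition `χ(n) = χ₂(n) (n/m)` of a primitive quadratic character mod `2^k m`,
`m` odd, at a natural number `n`. [cite: MontgomeryVaughan2007, Lemma 9.3] -/
theorem apply_natCast_eq_crtFst_mul_jacobiSym (hm : Odd m) {χ : DirichletCharacter ℂ (2 ^ k * m)}
    (hprim : χ.IsPrimitive) (hquad : χ.IsQuadratic) (n : ℕ) :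
    χ (n : ZMod (2 ^ k * m)) =
      crtFst (coprime_two_pow_of_odd k hm) χ (n : ZMod (2 ^ k)) * (J((n : ℤ) | m) : ℂ) := by
  have hcop := coprime_two_pow_of_odd k hm
  have := apply_intCast_eq_mul hcop χ n
  push_cast at this
  rw [this, apply_natCast_eq_jacobiSym hm (squarefree_of_level_two_pow_mul hm hprim hquad) _
    (isPrimitive_crtSnd hcop hprim) (IsQuadratic.crtSnd hcop hquad) n]

/-- The CRT decomposition at `−1`: `χ(−1) = χ₂(−1) χ₄(m)`. [cite: MontgomeryVaughan2007, Lemma 9.3] -/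
theorem apply_neg_one_eq_crtFst_mul_χ₄ (hm : Odd m) {χ : DirichletCharacter ℂ (2 ^ k * m)}
    (hprim : χ.IsPrimitive) (hquad : χ.IsQuadratic) :
    χ (-1) = crtFst (coprime_two_pow_of_odd k hm) χ (-1) * (ZMod.χ₄ m : ℂ) := by
  have hcop := coprime_two_pow_of_odd k hm
  have := apply_intCast_eq_mul hcop χ (-1)
  push_cast at this
  rw [this, apply_neg_one_eq_χ₄ hm (squarefree_of_level_two_pow_mul hm hprim hquad) _
    (isPrimitive_crtSnd hcop hprim) (IsQuadratic.crtSnd hcop hquad)]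

omit [NeZero m] in
/-- `χ₄(m)` for odd `m` is `1` or `−1` according as `m ≡ 1, 3 (mod 4)`. [folklore] -/
theorem χ₄_cast_eq_ite (hm : Odd m) : (ZMod.χ₄ m : ℂ) = if m % 4 = 1 then 1 else -1 := by
  rw [ZMod.χ₄_nat_eq_if_mod_four, if_neg (by have := Nat.odd_iff.mp hm; omega)]
  split_ifs <;> simp

/-- **Parity for `q = 4m`**: an odd primitive quadratic character mod `4m`, `m` odd, has
`m ≡ 1 (mod 4)` (`χ(−1) = χ₄(−1) χ₄(m) = −χ₄(m)`). [cite: MontgomeryVaughan2007, Theorem 9.13] -/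
theorem mod_four_eq_one_of_level_four_mul (hm : Odd m) {χ : DirichletCharacter ℂ (2 ^ 2 * m)}
    (hprim : χ.IsPrimitive) (hquad : χ.IsQuadratic) (hodd : χ.Odd) : m % 4 = 1 := by
  have hcop := coprime_two_pow_of_odd 2 hm
  have hodd' : χ (-1) = -1 := hodd
  have h3 : crtFst hcop χ (-1) = -1 := by
    rw [show (-1 : ZMod (2 ^ 2)) = (3 : ZMod 4) by decide]
    exact apply_three_of_isPrimitive_four (isPrimitive_crtFst hcop hprim) (IsQuadratic.crtFst hcop hquad)
  have hdec1 := apply_neg_one_eq_crtFst_mul_χ₄ hm hprim hquad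
  rw [hodd', h3, χ₄_cast_eq_ite hm] at hdec1
  by_contra hne
  rw [if_neg hne] at hdec1
  norm_num at hdec1

/-- **Parity for `q = 8m`**: an odd primitive quadratic character mod `8m`, `m` odd, has
`χ₂(3) = χ₄(m)` for its component `χ₂` mod `8` (`χ(−1) = χ₂(7) χ₄(m) = −χ₂(3) χ₄(m)`).
[cite: MontgomeryVaughan2007, Theorem 9.13] -/
theorem crtFst_three_eq_of_level_eight_mul (hm : Odd m) {χ : DirichletCharacter ℂ (2 ^ 3 * m)}
    (hprim : χ.IsPrimitive) (hquad : χ.IsQuadratic) (hodd : χ.Odd) :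
    crtFst (coprime_two_pow_of_odd 3 hm) χ (3 : ZMod (2 ^ 3)) = (ZMod.χ₄ m : ℂ) := by
  have hcop := coprime_two_pow_of_odd 3 hm
  have hodd' : χ (-1) = -1 := hodd
  have hp₂ := isPrimitive_crtFst hcop hprim
  have hq₂ := IsQuadratic.crtFst hcop hquad
  have h7 : crtFst hcop χ (-1) = -crtFst hcop χ (3 : ZMod (2 ^ 3)) := by
    rw [show (-1 : ZMod (2 ^ 3)) = ((7 : ℕ) : ZMod 8) by decide,
      apply_natCast_eight_eq hp₂ hq₂ (by decide : _root_.Odd 7)]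
    norm_num
  have hdec1 := apply_neg_one_eq_crtFst_mul_χ₄ hm hprim hquad
  rw [hodd', h7, χ₄_cast_eq_ite hm] at hdec1
  rw [χ₄_cast_eq_ite hm]
  have h3u : IsUnit (3 : ZMod (2 ^ 3)) := by decide
  rcases apply_eq_one_or_neg_one_of_isUnit hq₂ h3u with h | h
  · rw [h] at hdec1 ⊢
    by_cases hm4 : m % 4 = 1
    · rw [if_pos hm4]
    · rw [if_neg hm4] at hdec1
      norm_num at hdec1
  · rw [h] at hdec1 ⊢
    by_cases hm4 : m % 4 = 1
    · rw [if_pos hm4] at hdec1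
      norm_num at hdec1
    · rw [if_neg hm4]

end TwoPowMul

/-- The reciprocity sign for odd `m, n`: `qrSign n m = (−1)^{(n/2)(m/2)}` is `1` unless
`m ≡ n ≡ 3 (mod 4)`. [folklore] -/
theorem qrSign_eq_ite {m n : ℕ} (hm : _root_.Odd m) (hn : _root_.Odd n) :
    qrSign n m = if m % 4 = 1 then 1 else if n % 8 = 1 ∨ n % 8 = 5 then 1 else -1 := by
  rw [qrSign.neg_one_pow hn hm]
  have hm2 := Nat.odd_iff.mp hm
  have hn2 := Nat.odd_iff.mp hn
  rcases Nat.even_or_odd (m / 2) with he | ho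
  · rw [Even.neg_one_pow (he.mul_left _), if_pos (by rcases he with ⟨r, hr⟩; omega)]
  · rw [if_neg (by rcases ho with ⟨r, hr⟩; omega)]
    rcases Nat.even_or_odd (n / 2) with he' | ho'
    · rw [Even.neg_one_pow (he'.mul_right _), if_pos (by rcases he' with ⟨r, hr⟩; omega)]
    · rw [Odd.neg_one_pow (ho'.mul ho), if_neg (by rcases ho' with ⟨r, hr⟩; omega)]

/-! ### The main theorem -/

/-- **An odd primitive quadratic character mod `q` is the Kronecker symbol `(−q/·)` at odd
arguments**: for `χ` primitive, quadratic (`χ(a) ∈ {0, ±1}`) and odd (`χ(−1) = −1`) modulo `q`, and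
every odd natural number `n`, `χ(n) = (−q/n)` (Jacobi symbol). Cases: `q` odd (then `q ≡ 3 (mod 4)`
is squarefree and `χ = (·/q)`, `PrimitiveQuadraticCharacter.lean`); `q = 4m`, `m` odd (then
`χ = χ₄ ⊗ (·/m)` with `m ≡ 1 (mod 4)` by parity); `q = 8m`, `m` odd (then
`χ = χ₂ ⊗ (·/m)` with `χ₂ = χ₄χ₈` if `m ≡ 1`, `χ₂ = χ₈` if `m ≡ 3 (mod 4)`, by parity);
other `q` carry no primitive quadratic character. This is Montgomery–Vaughan's Theorem 9.13
("the primitive quadratic characters are the `χ_d(n) = (d/n)_K`, `d` a quadratic discriminant")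
for `d = −q < 0`. [cite: MontgomeryVaughan2007, Theorem 9.13] -/
theorem apply_natCast_eq_jacobiSym_neg_of_odd {q : ℕ} [NeZero q] {χ : DirichletCharacter ℂ q}
    (hprim : χ.IsPrimitive) (hquad : χ.IsQuadratic) (hodd : χ.Odd) {n : ℕ} (hn : Odd n) :
    χ (n : ZMod q) = (J(-(q : ℤ) | n) : ℂ) := by
  obtain ⟨k, m, hm, hq⟩ := Nat.exists_eq_two_pow_mul_odd (NeZero.ne q)
  subst hq
  have hm0 : m ≠ 0 := fun h => by simp [h] at hm
  haveI : NeZero m := ⟨hm0⟩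
  have hm2 : m % 2 = 1 := Nat.odd_iff.mp hm
  have hn2 : n % 2 = 1 := Nat.odd_iff.mp hn
  have hk3 : k ≤ 3 := le_three_of_level_two_pow_mul hm hprim hquad
  have hcop := coprime_two_pow_of_odd k hm
  interval_cases k
  · -- `q = m` odd
    have hoddq : _root_.Odd (2 ^ 0 * m : ℕ) := by simpa using hm
    have hsq := squarefree_of_isPrimitive_of_isQuadratic hoddq hprim hquad
    have hq3 := mod_four_eq_three_of_odd hoddq hprim hquad hodd
    rw [apply_natCast_eq_jacobiSym hoddq hsq χ hprim hquad n,
      ← jacobiSym_neg_eq_jacobiSym_of_mod_four hq3 hn]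
  · exact (not_isPrimitive_two_mul hm hprim).elim
  · -- `q = 4m`: `χ₂ = χ₄`, `m ≡ 1 (mod 4)`
    have hm1 := mod_four_eq_one_of_level_four_mul hm hprim hquad hodd
    rw [apply_natCast_eq_crtFst_mul_jacobiSym hm hprim hquad n,
      show ((n : ℕ) : ZMod (2 ^ 2)) = ((n : ℕ) : ZMod 4) from rfl,
      apply_natCast_four_eq (isPrimitive_crtFst hcop hprim) (IsQuadratic.crtFst hcop hquad) hn,
      show (2 ^ 2 * m : ℕ) = 4 * m by ring, jacobiSym_neg_four_mul hn,
      jacobiSym.quadratic_reciprocity_one_mod_four' hn hm1]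
    push_cast
    ring
  · -- `q = 8m`: `χ₂(3) = χ₄(m)`
    have hε := crtFst_three_eq_of_level_eight_mul hm hprim hquad hodd
    rw [apply_natCast_eq_crtFst_mul_jacobiSym hm hprim hquad n,
      show ((n : ℕ) : ZMod (2 ^ 3)) = ((n : ℕ) : ZMod 8) from rfl,
      apply_natCast_eight_eq (isPrimitive_crtFst hcop hprim) (IsQuadratic.crtFst hcop hquad) hn,
      show (3 : ZMod 8) = (3 : ZMod (2 ^ 3)) from rfl, hε, χ₄_cast_eq_ite hm,
      show (2 ^ 3 * m : ℕ) = 8 * m by ring, jacobiSym_neg_eight_mul hn, jacobiSym.at_neg_two hn,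
      jacobiSym.quadratic_reciprocity' hm hn, qrSign_eq_ite hm hn, ZMod.χ₈'_nat_eq_if_mod_eight]
    have h8 : n % 8 = 1 ∨ n % 8 = 3 ∨ n % 8 = 5 ∨ n % 8 = 7 := by omega
    by_cases hm4 : m % 4 = 1 <;> rcases h8 with h | h | h | h <;> simp [h, hm4, hn2]

/-- **At an odd prime `p`: `χ(p) = (−q/p)`** (Legendre symbol), for `χ` primitive, quadratic and
odd mod `q`. [cite: MontgomeryVaughan2007, Theorem 9.13] -/
theorem apply_prime_eq_legendreSym_neg_of_odd {q : ℕ} [NeZero q] {χ : DirichletCharacter ℂ q}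
    (hprim : χ.IsPrimitive) (hquad : χ.IsQuadratic) (hodd : χ.Odd) (p : ℕ) [Fact p.Prime]
    (hp2 : p ≠ 2) : χ (p : ZMod q) = (legendreSym p (-(q : ℤ)) : ℂ) := by
  rw [apply_natCast_eq_jacobiSym_neg_of_odd hprim hquad hodd ((Fact.out : p.Prime).odd_of_ne_two hp2),
    jacobiSym.legendreSym.to_jacobiSym]

/-! ### The value at `2` -/

/-- For even `q`, `χ(2) = 0`. [folklore] -/
theorem apply_two_of_even {q : ℕ} [NeZero q] (heven : Even q) (χ : DirichletCharacter ℂ q) :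
    χ (2 : ZMod q) = 0 := by
  refine χ.map_nonunit ?_
  rw [show (2 : ZMod q) = ((2 : ℕ) : ZMod q) by norm_cast, ZMod.isUnit_iff_coprime, Nat.coprime_two_left]
  exact Nat.not_odd_iff_even.mpr heven

/-- For odd `q` and `χ` primitive quadratic odd mod `q`: `χ(2) = 1` when `−q ≡ 1 (mod 8)`.
[cite: MontgomeryVaughan2007, Theorem 9.13] -/
theorem apply_two_eq_one_of_odd {q : ℕ} [NeZero q] (hq : Odd q) {χ : DirichletCharacter ℂ q}
    (hprim : χ.IsPrimitive) (hquad : χ.IsQuadratic) (hodd : χ.Odd) (h8 : (-(q : ℤ)) % 8 = 1) :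
    χ (2 : ZMod q) = 1 := by
  have hsq := squarefree_of_isPrimitive_of_isQuadratic hq hprim hquad
  have hq3 := mod_four_eq_three_of_odd hq hprim hquad hodd
  have hD4 : (-(q : ℤ)) % 4 = 1 := by omega
  have h := apply_natCast_eq_jacobiSym hq hsq χ hprim hquad 2
  rw [Nat.cast_ofNat] at h
  rw [h]
  have := (Literature.NumberTheory.QuadraticFields.jacobiSym_two_natAbs_eq_one_iff hD4).mpr h8
  rw [Int.natAbs_neg, Int.natAbs_natCast] at this
  rw [Nat.cast_ofNat, this, Int.cast_one]

/-- For odd `q` and `χ` primitive quadratic odd mod `q`: `χ(2) = −1` when `−q ≡ 5 (mod 8)`.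
[cite: MontgomeryVaughan2007, Theorem 9.13] -/
theorem apply_two_eq_neg_one_of_odd {q : ℕ} [NeZero q] (hq : Odd q) {χ : DirichletCharacter ℂ q}
    (hprim : χ.IsPrimitive) (hquad : χ.IsQuadratic) (hodd : χ.Odd) (h8 : (-(q : ℤ)) % 8 = 5) :
    χ (2 : ZMod q) = -1 := by
  have hsq := squarefree_of_isPrimitive_of_isQuadratic hq hprim hquad
  have hq3 := mod_four_eq_three_of_odd hq hprim hquad hodd
  have hD4 : (-(q : ℤ)) % 4 = 1 := by omega
  have h := apply_natCast_eq_jacobiSym hq hsq χ hprim hquad 2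
  rw [Nat.cast_ofNat] at h
  rw [h]
  have := (Literature.NumberTheory.QuadraticFields.jacobiSym_two_natAbs_eq_neg_one_iff hD4).mpr h8
  rw [Int.natAbs_neg, Int.natAbs_natCast] at this
  rw [Nat.cast_ofNat, this, Int.cast_neg, Int.cast_one]

/-! ### `−q` is a fundamental discriminant -/

/-- **The modulus of an odd primitive quadratic character is minus a fundamental discriminant**:
either `q ≡ 3 (mod 4)` is squarefree (`−q ≡ 1 (mod 4)`), or `q = 4m'` with `−m' ≡ 2, 3 (mod 4)`
squarefree (i.e. `q = 4m`, `m ≡ 1 (mod 4)` squarefree, or `q = 8m`, `m` odd squarefree) — the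
condition `IsFundamentalDiscriminant (−q)` of `QuadraticFields/FundamentalDiscriminant.lean`, spelled
out. [cite: MontgomeryVaughan2007, Theorem 9.13] -/
theorem isFundamentalDiscriminant_neg {q : ℕ} [NeZero q] {χ : DirichletCharacter ℂ q}
    (hprim : χ.IsPrimitive) (hquad : χ.IsQuadratic) (hodd : χ.Odd) :
    ((-(q : ℤ)) % 4 = 1 ∧ Squarefree (-(q : ℤ)) ∧ (-(q : ℤ)) ≠ 1) ∨
      (4 ∣ (-(q : ℤ)) ∧ ((-(q : ℤ)) / 4 % 4 = 2 ∨ (-(q : ℤ)) / 4 % 4 = 3) ∧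
        Squarefree ((-(q : ℤ)) / 4)) := by
  obtain ⟨k, m, hm, hq⟩ := Nat.exists_eq_two_pow_mul_odd (NeZero.ne q)
  subst hq
  have hm0 : m ≠ 0 := fun h => by simp [h] at hm
  haveI : NeZero m := ⟨hm0⟩
  have hm2 : m % 2 = 1 := Nat.odd_iff.mp hm
  have hk3 : k ≤ 3 := le_three_of_level_two_pow_mul hm hprim hquad
  have hmsq : Squarefree m := squarefree_of_level_two_pow_mul hm hprim hquad
  have hmsqZ : Squarefree (m : ℤ) := by rwa [← Int.squarefree_natAbs, Int.natAbs_natCast]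
  interval_cases k
  · left
    have hoddq : _root_.Odd (2 ^ 0 * m : ℕ) := by simpa using hm
    have hq3 := mod_four_eq_three_of_odd hoddq hprim hquad hodd
    simp only [pow_zero, one_mul] at hq3 ⊢
    refine ⟨by omega, ?_, by omega⟩
    rwa [← Int.squarefree_natAbs, Int.natAbs_neg, Int.natAbs_natCast]
  · exact (not_isPrimitive_two_mul hm hprim).elim
  · right
    have hm1 := mod_four_eq_one_of_level_four_mul hm hprim hquad hodd
    have e : (-(((2 ^ 2 * m : ℕ)) : ℤ)) / 4 = -(m : ℤ) := by push_cast; omega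
    refine ⟨⟨-(m : ℤ), by push_cast; ring⟩, ?_, ?_⟩
    · rw [e]; omega
    · rw [e, ← Int.squarefree_natAbs, Int.natAbs_neg, Int.natAbs_natCast]
      exact hmsq
  · right
    have e : (-(((2 ^ 3 * m : ℕ)) : ℤ)) / 4 = -(2 * (m : ℤ)) := by push_cast; omega
    refine ⟨⟨-(2 * (m : ℤ)), by push_cast; ring⟩, ?_, ?_⟩
    · rw [e]; omega
    · rw [e, ← Int.squarefree_natAbs, Int.natAbs_neg, show (2 * (m : ℤ)).natAbs = 2 * m by
        rw [Int.natAbs_mul]; simp]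
      rw [Nat.squarefree_mul (Nat.coprime_two_left.mpr hm)]
      exact ⟨Nat.prime_two.prime.squarefree, hmsq⟩

end Literature.NumberTheory.LFunctions.PrimitiveQuadratic
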